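import Summits.CriticalPhenomena.CardyFormulaZ2.Theses.CardyBoundaryCoulombGas

/-!
# Relaxation of a finite stochastic matrix towards a state reached from everywhere in one step

Helper for stub `stub_relaxationUpper` (S2a) of line `two-cluster-rate-is-stationary-gap` of crux
`CardyBoundaryCoulombGas.StripClusterRates` (stmt-CriticalPhenomena-13878): the pure linear-algebra
half of "the two-cluster rate is the relaxation rate of the stationary connectivity chain".

Let `U` be a stochastic real matrix on a finite index type `ι` (nonnegative entries, row sums `1`)
and `z : ι` a state charged by every row (`0 < U a z` for all `a`; for the unmarked block of the
planar `⋆`-chain `z` is the free pattern, reached in one step by closing every vertical bond).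
Then (`s2a_stochastic_relaxation_of`; registered `∀`-form `s2a_stochastic_relaxation`):

* (SLEM) if `ι` has a second point, the set of complex eigenvalues `μ ≠ 1` of `U` is finite and
  nonempty, so it has an element of maximal modulus `s` (the second-largest eigenvalue modulus);
* (relaxation bound) for every `s' > s` and every real observable `g`, the oscillation of `U^m g`
  is `O(s'^m)`: `(U^m g)(a) - (U^m g)(b) ≤ K s'^m`.

Proof (no irreducibility or aperiodicity is used): harmonic functions are constant (maximum
principle through the column `z`), and the constant function `1` is not in the range of `U - 1`
(`U` contracts the sup norm, whereas `(U - 1) g = 1` would force `U^m g = g + m`); hence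
`ℂ^ι = ℂ·1 ⊕ range (U - 1)`, the second summand `W` is `U`-invariant, the eigenvalues of `U|_W` are
eigenvalues `≠ 1` of `U`, and Gelfand's formula for `U|_W` in the Banach algebra of continuous linear
maps of `W` (Mathlib `spectrum.pow_nnnorm_pow_one_div_tendsto_nhds_spectralRadius`) bounds
`‖(U|_W)^m‖ ≤ C s'^m`; the constant part of `g` cancels in the difference.

Sources: Levin–Peres–Wilmer, *Markov chains and mixing times* (2009), §12.2 and Cor. 12.6 (spectral
form of the relaxation of a finite chain); Gelfand's spectral radius formula (Mathlib).
-/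

noncomputable section

namespace Summit.CriticalPhenomena.CardyFormulaZ2.Cruxes.StripClusterRates.TwoClusterRateIsStationaryGap

open Filter Topology Matrix
open scoped BigOperators ENNReal NNReal

variable {ι : Type*} [Fintype ι]

/-- **Maximum principle.** For a stochastic matrix `U` with a column `z` charged by every row, a
real harmonic function (`U h = h`) is constant (Levin–Peres–Wilmer 2009, Lemma 1.16). [folklore] -/
theorem s2a_harmonic_const (U : Matrix ι ι ℝ) (h0 : ∀ a b, 0 ≤ U a b) (h1 : ∀ a, ∑ b, U a b = 1)
    (z : ι) (hz : ∀ a, 0 < U a z) (h : ι → ℝ) (hh : ∀ a, ∑ b, U a b * h b = h a) (a : ι) :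
    h a = h z := by
  haveI : Nonempty ι := ⟨z⟩
  -- the value at `z` is the maximum
  have hmax : ∀ a, h a ≤ h z := by
    obtain ⟨a₀, ha₀⟩ := Finite.exists_max h
    have hsum : ∑ b, U a₀ b * (h a₀ - h b) = 0 := by
      simp_rw [mul_sub]
      rw [Finset.sum_sub_distrib, ← Finset.sum_mul, h1, one_mul, hh, sub_self]
    have hterm := (Finset.sum_eq_zero_iff_of_nonneg (fun b _ =>
      mul_nonneg (h0 a₀ b) (sub_nonneg.2 (ha₀ b)))).1 hsum z (Finset.mem_univ z)
    have hz' : h a₀ - h z = 0 := by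
      rcases mul_eq_zero.1 hterm with h' | h'
      · exact absurd h' (hz a₀).ne'
      · exact h'
    intro a
    linarith [ha₀ a]
  -- the value at `z` is the minimum
  have hmin : ∀ a, h z ≤ h a := by
    obtain ⟨a₀, ha₀⟩ := Finite.exists_min h
    have hsum : ∑ b, U a₀ b * (h b - h a₀) = 0 := by
      simp_rw [mul_sub]
      rw [Finset.sum_sub_distrib, ← Finset.sum_mul, h1, one_mul, hh, sub_self]
    have hterm := (Finset.sum_eq_zero_iff_of_nonneg (fun b _ =>
      mul_nonneg (h0 a₀ b) (sub_nonneg.2 (ha₀ b)))).1 hsum z (Finset.mem_univ z)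
    have hz' : h z - h a₀ = 0 := by
      rcases mul_eq_zero.1 hterm with h' | h'
      · exact absurd h' (hz a₀).ne'
      · exact h'
    intro a
    linarith [ha₀ a]
  exact le_antisymm (hmax a) (hmin a)

/-- A stochastic matrix contracts the sup norm of complex observables. [folklore] -/
theorem s2a_norm_mulVec_le (U : Matrix ι ι ℝ) (h0 : ∀ a b, 0 ≤ U a b) (h1 : ∀ a, ∑ b, U a b = 1)
    (v : ι → ℂ) : ‖U.map (⇑Complex.ofRealHom) *ᵥ v‖ ≤ ‖v‖ := by
  refine (pi_norm_le_iff_of_nonneg (norm_nonneg v)).2 fun a => ?_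
  have hrow : (U.map (⇑Complex.ofRealHom) *ᵥ v) a = ∑ b, (U a b : ℂ) * v b := by
    simp [Matrix.mulVec, dotProduct]
  rw [hrow]
  calc ‖∑ b, (U a b : ℂ) * v b‖ ≤ ∑ b, ‖(U a b : ℂ) * v b‖ := norm_sum_le _ _
    _ ≤ ∑ b, U a b * ‖v‖ := Finset.sum_le_sum fun b _ => by
        rw [norm_mul, Complex.norm_real, Real.norm_of_nonneg (h0 a b)]
        exact mul_le_mul_of_nonneg_left (norm_le_pi_norm v b) (h0 a b)
    _ = ‖v‖ := by rw [← Finset.sum_mul, h1, one_mul]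

/-- **Relaxation of a finite stochastic matrix with a state reached from everywhere in one step.**
Let `U` be stochastic on the finite type `ι`, `0 < U a z` for every `a`, and let `ι` have a point
other than `z`. Then there is `s : ℝ` (the second-largest eigenvalue modulus) such that
(i) some complex eigenpair `(μ, v)` of `U` with `μ ≠ 1` has `‖μ‖ = s` and every complex eigenpair
with `μ ≠ 1` has `‖μ‖ ≤ s`, and (ii) for every `s' > s` and every real observable `g` there is `K`
with `(U^m g)(a) - (U^m g)(b) ≤ K s'^m` for all `m, a, b`. Source: Levin–Peres–Wilmer, *Markov
chains and mixing times* (2009), §12.2 / Cor. 12.6; Gelfand's formula. [folklore] -/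
theorem s2a_stochastic_relaxation_of [DecidableEq ι] (U : Matrix ι ι ℝ) (h0 : ∀ a b, 0 ≤ U a b)
    (h1 : ∀ a, ∑ b, U a b = 1) (z : ι) (hz : ∀ a, 0 < U a z) (hnt : ∃ a, a ≠ z) :
    ∃ s : ℝ,
      ((∃ (μ : ℂ) (v : ι → ℂ), (v ≠ 0 ∧ ∀ a, ∑ b, (U a b : ℂ) * v b = μ * v a) ∧ μ ≠ 1 ∧ ‖μ‖ = s) ∧
        ∀ (μ : ℂ) (v : ι → ℂ), (v ≠ 0 ∧ ∀ a, ∑ b, (U a b : ℂ) * v b = μ * v a) →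
          μ ≠ 1 → ‖μ‖ ≤ s) ∧
      ∀ s' : ℝ, s < s' → ∀ g : ι → ℝ, ∃ K : ℝ, ∀ (m : ℕ) (a b : ι),
        (U ^ m *ᵥ g) a - (U ^ m *ᵥ g) b ≤ K * s' ^ m := by
  haveI : Nonempty ι := ⟨z⟩
  -- the complexified matrix as a linear map
  set Uc : Matrix ι ι ℂ := U.map (⇑Complex.ofRealHom) with hUc
  set L : Module.End ℂ (ι → ℂ) := Matrix.toLin' Uc with hLdef
  have hL : ∀ (v : ι → ℂ) (a : ι), L v a = ∑ b, (U a b : ℂ) * v b := by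
    intro v a
    simp [hLdef, hUc, Matrix.toLin'_apply, Matrix.mulVec, dotProduct]
  have hLv : ∀ v : ι → ℂ, L v = Uc *ᵥ v := fun v => Matrix.toLin'_apply _ _
  have hLpow : ∀ (m : ℕ) (v : ι → ℂ), (L ^ m) v = Uc ^ m *ᵥ v := by
    intro m
    induction m with
    | zero => intro v; simp
    | succ m ih =>
      intro v
      rw [pow_succ, Module.End.mul_apply, hLv, ih, Matrix.mulVec_mulVec, ← pow_succ]
  -- sup-norm contraction of the powers
  have hnorm : ∀ (m : ℕ) (v : ι → ℂ), ‖(L ^ m) v‖ ≤ ‖v‖ := by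
    intro m
    induction m with
    | zero => intro v; simp
    | succ m ih =>
      intro v
      rw [pow_succ', Module.End.mul_apply, hLv]
      exact (s2a_norm_mulVec_le U h0 h1 _).trans (ih v)
  -- the constant function
  set one : ι → ℂ := fun _ => 1 with hone
  have hone0 : one ≠ 0 := fun h => by simpa [hone] using congrFun h z
  have hLone : L one = one := by
    funext a
    rw [hL]
    simp only [hone, mul_one]
    exact_mod_cast h1 a
  have hLpow_one : ∀ m : ℕ, (L ^ m) one = one := by
    intro m
    induction m with
    | zero => simp
    | succ m ih => rw [pow_succ', Module.End.mul_apply, ih, hLone]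
  -- (K1) harmonic functions are constant
  have hK1 : ∀ v : ι → ℂ, L v = v → ∀ a, v a = v z := by
    intro v hv a
    have hre : ∀ a, ∑ b, U a b * (v b).re = (v a).re := by
      intro a
      have := congrArg Complex.re (hL v a)
      rw [hv] at this
      rw [this, Complex.re_sum]
      simp [Complex.mul_re]
    have him : ∀ a, ∑ b, U a b * (v b).im = (v a).im := by
      intro a
      have := congrArg Complex.im (hL v a)
      rw [hv] at this
      rw [this, Complex.im_sum]
      simp [Complex.mul_im]
    apply Complex.ext
    · exact s2a_harmonic_const U h0 h1 z hz (fun b => (v b).re) hre a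
    · exact s2a_harmonic_const U h0 h1 z hz (fun b => (v b).im) him a
  -- (K2) `one` is not in the range of `L - 1`
  set W : Submodule ℂ (ι → ℂ) := LinearMap.range (L - 1) with hWdef
  have hK2 : one ∉ W := by
    rintro ⟨g, hg⟩
    have hLg : L g = g + one := by
      have : L g - g = one := by simpa [LinearMap.sub_apply] using hg
      rw [← this]; abel
    have hiter : ∀ m : ℕ, (L ^ m) g = g + (m : ℂ) • one := by
      intro m
      induction m with
      | zero => simp
      | succ m ih =>
        rw [pow_succ', Module.End.mul_apply, ih, map_add, map_smul, hLg, hLone]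
        simp only [Nat.cast_succ, add_smul, one_smul]
        abel
    set m : ℕ := ⌊2 * ‖g‖⌋₊ + 1 with hmdef
    have hm : 2 * ‖g‖ < m := by rw [hmdef]; exact_mod_cast Nat.lt_floor_add_one (2 * ‖g‖)
    have h1' : ‖((L ^ m) g) z‖ ≤ ‖g‖ := (norm_le_pi_norm _ z).trans (hnorm m g)
    rw [hiter] at h1'
    have h2 : ((g + (m : ℂ) • one) z) = g z + m := by simp [hone]
    rw [h2] at h1'
    have h3 : (m : ℝ) ≤ ‖g z + m‖ + ‖g z‖ := by
      have := norm_sub_le (g z + m) (g z)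
      rwa [add_sub_cancel_left, Complex.norm_natCast] at this
    have h4 : ‖g z‖ ≤ ‖g‖ := norm_le_pi_norm g z
    linarith
  -- (K3) `ℂ·one ⊕ W` is everything
  have hker : LinearMap.ker (L - 1) ≤ ℂ ∙ one := by
    intro v hv
    rw [LinearMap.mem_ker, LinearMap.sub_apply, Module.End.one_apply, sub_eq_zero] at hv
    exact Submodule.mem_span_singleton.2 ⟨v z, funext fun a => by simp [hone, hK1 v hv a]⟩
  have hdisj : Disjoint (ℂ ∙ one) W := by
    rw [disjoint_comm]
    exact (Submodule.disjoint_span_singleton' hone0).2 hK2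
  have hspan1 : Module.finrank ℂ (ℂ ∙ one) = 1 := finrank_span_singleton hone0
  have hrn := LinearMap.finrank_range_add_finrank_ker (L - 1)
  rw [Module.finrank_fintype_fun_eq_card] at hrn
  have hkerle : Module.finrank ℂ (LinearMap.ker (L - 1)) ≤ 1 :=
    hspan1 ▸ Submodule.finrank_mono hker
  have hsup : (ℂ ∙ one) ⊔ W = ⊤ := by
    apply Submodule.eq_top_of_disjoint _ _ _ hdisj
    rw [Module.finrank_fintype_fun_eq_card, hspan1]
    change Fintype.card ι ≤ 1 + Module.finrank ℂ (LinearMap.range (L - 1))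
    omega
  have hdecomp : ∀ f : ι → ℂ, ∃ (c : ℂ) (w : ι → ℂ), w ∈ W ∧ f = c • one + w := by
    intro f
    have hf : f ∈ (ℂ ∙ one) ⊔ W := by rw [hsup]; exact Submodule.mem_top
    obtain ⟨y, hy, w, hw, hyw⟩ := Submodule.mem_sup.1 hf
    obtain ⟨c, rfl⟩ := Submodule.mem_span_singleton.1 hy
    exact ⟨c, w, hw, hyw.symm⟩
  -- `W` is invariant; the restriction `A`
  have hWinv : ∀ w ∈ W, L w ∈ W := by
    rintro w ⟨y, rfl⟩
    refine ⟨L y, ?_⟩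
    simp [LinearMap.sub_apply, map_sub]
  set A : Module.End ℂ W := L.restrict hWinv with hAdef
  have hAcoe : ∀ x : W, ((A x : W) : ι → ℂ) = L x := fun x => rfl
  -- the eigen-set `E` of eigenvalues `≠ 1`
  set E : Set ℂ := {μ | μ ≠ 1 ∧ ∃ v : ι → ℂ, v ≠ 0 ∧ ∀ a, ∑ b, (U a b : ℂ) * v b = μ * v a}
    with hE
  have hEfin : E.Finite := by
    refine (Module.End.finite_hasEigenvalue L).subset ?_
    rintro μ ⟨-, v, hv0, hv⟩
    change L.HasEigenvalue μ
    refine Module.End.hasEigenvalue_of_hasEigenvector (x := v)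
      (Module.End.hasEigenvector_iff.2 ⟨?_, hv0⟩)
    rw [Module.End.mem_eigenspace_iff]
    funext a
    rw [hL, Pi.smul_apply, smul_eq_mul]
    exact hv a
  have hAE : ∀ μ : ℂ, A.HasEigenvalue μ → μ ∈ E := by
    intro μ hμ
    obtain ⟨x, hx⟩ := hμ.exists_hasEigenvector
    have hx0 : (x : ι → ℂ) ≠ 0 := fun h => hx.2 (Submodule.coe_eq_zero.1 h)
    have hLx : L x = μ • (x : ι → ℂ) := by
      have := congrArg Subtype.val hx.apply_eq_smul
      simpa [hAcoe] using this
    refine ⟨?_, x, hx0, fun a => ?_⟩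
    · rintro rfl
      rw [one_smul] at hLx
      have hxspan : (x : ι → ℂ) ∈ ℂ ∙ one :=
        Submodule.mem_span_singleton.2 ⟨(x : ι → ℂ) z, funext fun a => by simp [hone, hK1 _ hLx a]⟩
      exact hx0 ((Submodule.disjoint_def.1 hdisj) _ hxspan x.2)
    · rw [← hL, hLx, Pi.smul_apply, smul_eq_mul]
  -- `W` is nontrivial, so `A` has an eigenvalue: `E` is nonempty
  have hcard : 1 < Fintype.card ι := by
    obtain ⟨a, ha⟩ := hnt
    exact Fintype.one_lt_card_iff.2 ⟨a, z, ha⟩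
  haveI : Nontrivial W := by
    apply Module.nontrivial_of_finrank_pos (R := ℂ)
    change 0 < Module.finrank ℂ (LinearMap.range (L - 1))
    omega
  obtain ⟨μ₁, hμ₁⟩ := Module.End.exists_eigenvalue A
  have hEne : E.Nonempty := ⟨μ₁, hAE μ₁ hμ₁⟩
  obtain ⟨μ₀, hμ₀E, hmax⟩ := Set.exists_max_image E (fun μ => ‖μ‖) hEfin hEne
  refine ⟨‖μ₀‖, ⟨?_, ?_⟩, ?_⟩
  · obtain ⟨hμ₀1, v, hv0, hv⟩ := hμ₀E
    exact ⟨μ₀, v, ⟨hv0, hv⟩, hμ₀1, rfl⟩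
  · rintro μ v ⟨hv0, hv⟩ hμ1
    exact hmax μ ⟨hμ1, v, hv0, hv⟩
  -- (B) the relaxation bound through Gelfand's formula for `A`
  intro s' hs' g
  have hs'0 : 0 < s' := lt_of_le_of_lt (norm_nonneg μ₀) hs'
  haveI : CompleteSpace W := FiniteDimensional.complete ℂ W
  set Ac : W →L[ℂ] W := Module.End.toContinuousLinearMap W A with hAcdef
  have hAc_apply : ∀ (m : ℕ) (x : W), (Ac ^ m) x = (A ^ m) x := by
    intro m x
    rw [hAcdef, ← map_pow]
    rfl
  have hApow : ∀ (m : ℕ) (x : W), (((A ^ m) x : W) : ι → ℂ) = (L ^ m) x := by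
    intro m x
    rw [Module.End.pow_restrict m hWinv]
    rfl
  have hspec : ∀ k ∈ spectrum ℂ Ac, ‖k‖ ≤ ‖μ₀‖ := by
    intro k hk
    rw [hAcdef, AlgEquiv.spectrum_eq] at hk
    exact hmax k (hAE k (Module.End.hasEigenvalue_iff_mem_spectrum.2 hk))
  have hrad : spectralRadius ℂ Ac ≤ (‖μ₀‖₊ : ℝ≥0∞) := by
    refine iSup₂_le fun k hk => ?_
    exact_mod_cast hspec k hk
  set t : ℝ≥0 := ⟨s', hs'0.le⟩ with ht
  have hlt : spectralRadius ℂ Ac < (t : ℝ≥0∞) := by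
    refine lt_of_le_of_lt hrad (ENNReal.coe_lt_coe.2 ?_)
    change ‖μ₀‖ < s'
    exact hs'
  have hlim := spectrum.pow_nnnorm_pow_one_div_tendsto_nhds_spectralRadius Ac
  have hev : ∀ᶠ n : ℕ in atTop, (‖Ac ^ n‖₊ : ℝ≥0∞) ^ (1 / n : ℝ) < t :=
    (tendsto_order.1 hlim).2 _ hlt
  have hev' : ∀ᶠ n : ℕ in atTop, ‖Ac ^ n‖ ≤ s' ^ n := by
    filter_upwards [hev, eventually_ge_atTop 1] with n hn hn1
    have hnpos : (0 : ℝ) < n := by exact_mod_cast hn1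
    rw [one_div, ENNReal.rpow_inv_lt_iff hnpos, ENNReal.rpow_natCast, ← ENNReal.coe_pow,
      ENNReal.coe_lt_coe] at hn
    have : (‖Ac ^ n‖₊ : ℝ) < (t : ℝ) ^ n := by exact_mod_cast hn
    exact this.le
  obtain ⟨N, hN⟩ := eventually_atTop.1 hev'
  set C : ℝ := (∑ n ∈ Finset.range N, ‖Ac ^ n‖ / s' ^ n) + 1 with hCdef
  have hCsum : 0 ≤ ∑ n ∈ Finset.range N, ‖Ac ^ n‖ / s' ^ n :=
    Finset.sum_nonneg fun n _ => div_nonneg (norm_nonneg (Ac ^ n)) (pow_nonneg hs'0.le n)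
  have hC : ∀ m : ℕ, ‖Ac ^ m‖ ≤ C * s' ^ m := by
    intro m
    by_cases hm : N ≤ m
    · calc ‖Ac ^ m‖ ≤ s' ^ m := hN m hm
        _ = 1 * s' ^ m := (one_mul _).symm
        _ ≤ C * s' ^ m := mul_le_mul_of_nonneg_right (by rw [hCdef]; linarith) (pow_nonneg hs'0.le m)
    · have hmN : m ∈ Finset.range N := Finset.mem_range.2 (not_le.1 hm)
      have h1 : ‖Ac ^ m‖ / s' ^ m ≤ ∑ n ∈ Finset.range N, ‖Ac ^ n‖ / s' ^ n :=
        Finset.single_le_sum (fun n _ => div_nonneg (norm_nonneg (Ac ^ n)) (pow_nonneg hs'0.le n)) hmN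
      have hpos : 0 < s' ^ m := pow_pos hs'0 m
      calc ‖Ac ^ m‖ = (‖Ac ^ m‖ / s' ^ m) * s' ^ m := (div_mul_cancel₀ _ hpos.ne').symm
        _ ≤ C * s' ^ m := mul_le_mul_of_nonneg_right (by rw [hCdef]; linarith) hpos.le
  -- decompose the complexified observable
  set f : ι → ℂ := fun a => (g a : ℂ) with hfdef
  obtain ⟨c, w, hw, hfw⟩ := hdecomp f
  set x : W := ⟨w, hw⟩ with hxdef
  refine ⟨2 * C * ‖x‖, fun m a b => ?_⟩
  -- real powers as real parts of complex powers
  have hreal : ∀ a, (U ^ m *ᵥ g) a = ((L ^ m) f a).re := by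
    intro a
    rw [hLpow, hUc, ← Matrix.map_pow]
    have := RingHom.map_mulVec Complex.ofRealHom (U ^ m) g a
    have hfg : f = ⇑Complex.ofRealHom ∘ g := rfl
    rw [hfg, ← this]
    simp
  have hLmf : (L ^ m) f = c • one + (L ^ m) w := by
    rw [hfw, map_add, map_smul, hLpow_one]
  have hdiff : (U ^ m *ᵥ g) a - (U ^ m *ᵥ g) b = (((L ^ m) w) a - ((L ^ m) w) b).re := by
    rw [hreal, hreal, ← Complex.sub_re, hLmf]
    simp [hone]
  rw [hdiff]
  have hwA : (L ^ m) w = (((Ac ^ m) x : W) : ι → ℂ) := by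
    rw [hAc_apply, hApow]
  calc (((L ^ m) w) a - ((L ^ m) w) b).re ≤ ‖((L ^ m) w) a - ((L ^ m) w) b‖ := Complex.re_le_norm _
    _ ≤ ‖((L ^ m) w) a‖ + ‖((L ^ m) w) b‖ := norm_sub_le _ _
    _ ≤ ‖(L ^ m) w‖ + ‖(L ^ m) w‖ := add_le_add (norm_le_pi_norm _ a) (norm_le_pi_norm _ b)
    _ = 2 * ‖(Ac ^ m) x‖ := by rw [hwA, Submodule.coe_norm]; ring
    _ ≤ 2 * (‖Ac ^ m‖ * ‖x‖) :=
        mul_le_mul_of_nonneg_left (ContinuousLinearMap.le_opNorm _ _) (by norm_num)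
    _ ≤ 2 * (C * s' ^ m * ‖x‖) :=
        mul_le_mul_of_nonneg_left (mul_le_mul_of_nonneg_right (hC m) (norm_nonneg _)) (by norm_num)
    _ = 2 * C * ‖x‖ * s' ^ m := by ring

/-- **Registered form** of `s2a_stochastic_relaxation_of` (index types in `Type`, `Matrix.mulVec`
spelled out): the SLEM of a finite stochastic matrix with a column charged by every row exists and
bounds the oscillation of `U^m g` through every `s' > s`. [folklore] -/
theorem s2a_stochastic_relaxation : ∀ {ι : Type} [Fintype ι] [DecidableEq ι] (U : Matrix ι ι ℝ),
    (∀ a b, 0 ≤ U a b) → (∀ a, ∑ b, U a b = 1) → ∀ z : ι, (∀ a, 0 < U a z) → (∃ a, a ≠ z) →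
    ∃ s : ℝ,
      ((∃ (μ : ℂ) (v : ι → ℂ), (v ≠ 0 ∧ ∀ a, ∑ b, (U a b : ℂ) * v b = μ * v a) ∧ μ ≠ 1 ∧ ‖μ‖ = s) ∧
        ∀ (μ : ℂ) (v : ι → ℂ), (v ≠ 0 ∧ ∀ a, ∑ b, (U a b : ℂ) * v b = μ * v a) →
          μ ≠ 1 → ‖μ‖ ≤ s) ∧
      ∀ s' : ℝ, s < s' → ∀ g : ι → ℝ, ∃ K : ℝ, ∀ (m : ℕ) (a b : ι),
        (U ^ m).mulVec g a - (U ^ m).mulVec g b ≤ K * s' ^ m :=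
  fun U h0 h1 z hz hnt => s2a_stochastic_relaxation_of U h0 h1 z hz hnt

end Summit.CriticalPhenomena.CardyFormulaZ2.Cruxes.StripClusterRates.TwoClusterRateIsStationaryGap

end
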